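import Literature.MathematicalPhysics.QuantumLattice.StrongCouplingDeterminantRepresentation
import Literature.MathematicalPhysics.QuantumLattice.StaggeredChiralWardIdentity
import HarnessLib

/-!
# The massless staggered fermion determinant at every coupling: non-negativity, positivity of the
# `m = 0` partition function, and the chiral selection rule for the propagator contraction

Salmhofer–Seiler, Commun. Math. Phys. **139** (1991) 395–432 [SalmhoferSeiler1991]: `U(N)` lattice
gauge theory with one-component staggered fermions on the even torus `(ℤ/Lℤ)^ν`.  In the
determinant/propagator ("fermions integrated out") vocabulary of the typed conjecture
`Summit.Ventures.YMGap.Conjectures.SalmhoferSeilerSmallBeta` the fermionic weight at zero mass is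
`det D₀[U]` and the two-point function of the order field `ψ̄ψ` is the Haar-with-Wilson-density
integral of `Re det D₀[U] · Re W_{xy}(D₀[U]⁻¹)` over that of `Re det D₀[U]`
(`StrongCoupling.wick2`, module `StrongCouplingDeterminantRepresentation`).  This file proves three
structural facts valid at EVERY coupling `β` (the Wilson weight `wilsonWeight ρ β` only enters as a
measure with an everywhere positive density):

* `det_D0_re_nonneg` — **`det D₀[U] ≥ 0` for every gauge field** (even `L`): the limit `m → 0⁺` of
  the tree's `StaggeredDeterminant.det_staggeredDirac_pos` (`det D_m[U] > 0`, `m > 0`,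
  DeGrand–DeTar (8.5)); with `det_D0_im` of `StrongCouplingDeterminantRepresentation` the
  determinant is a non-negative real;
* `integral_det_D0_re_wilsonWeight_pos` — **`Z_Λ(β, 0) = ∫ Re det D₀ d(wilsonWeight ρ β) > 0` for
  every real `β`** (`ν ≥ 1`): `det D₀ ≥ 0` everywhere, `> 0` off the Haar-null singular set
  (`StaggeredSingular.measure_pi_setOf_det_staggeredDirac_eq_zero`), and the Wilson weight has the
  positive density `e^{-βS_W}`; so the conjecture's normalised expectation at `m = 0` is a genuine
  quotient at every `β` (its docstring: «whence `Z_Λ(β, 0) > 0` for every `β`»);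
* `wick2_inv_D0_eq_zero_of_sgn_eq` — **the `m = 0` chiral selection rule for the propagator
  contraction, for EVERY gauge field**: `W_{xy}(D₀[U]⁻¹) = 0` whenever `ε(x) = ε(y)`
  (`ε = ComplexSpin.sgn`, Salmhofer–Seiler (2.8)); on the singular set by the junk value
  `D₀[U]⁻¹ = 0`, elsewhere by the fixed-gauge-field chiral grading (3.101)/(3.106)
  (`StrongCoupling.twoPoint_chiralGrading_torus_fixedGauge`, module `StaggeredChiralWardIdentity`)
  transported through the Wick rule (`StrongCoupling.berezin_meson_meson_fermiBoltzmann_torus`).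
  Hence `∫ Re det D₀ · Re W_{xy}(D₀⁻¹) dμ = 0` for every measure `μ` — in particular for
  `wilsonWeight ρ β` at every `β` (`integral_det_D0_re_mul_wick2_re_eq_zero`): at `m = 0` the
  two-point function of the conjecture vanishes between sites of equal parity at every coupling,
  «only odd sites `ε(x) = -1` contribute» (the conjecture's docstring, (3.101)).

Scope (honest framing): lattice statements at fixed spacing for the tree's periodic `staggeredDirac`
in the defining representation of `U(N)`; `β` arbitrary real only because nothing here depends on
the gauge action beyond positivity of its Boltzmann factor; nothing about long-range order at
`β > 0` (the conjecture), `SU(N)`, the continuum, or a mass gap.  No facts, no `sorry`.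

## References

* M. Salmhofer, E. Seiler, Commun. Math. Phys. 139 (1991) 395–432, §2 (2.8)–(2.12), §3 (3.101),
  (3.106) [SalmhoferSeiler1991].
* T. DeGrand, C. DeTar, *Lattice Methods for Quantum Chromodynamics* (2006), §8.1 (8.5)
  [DegrandDetar2006] (positivity of the staggered determinant).
-/

noncomputable section

open MeasureTheory Matrix Complex Finset Filter
open Literature.MathematicalPhysics.QuantumFieldTheory
open Literature.Probability.LatticeModels (TorusSite)
open Literature.MathematicalPhysics.StatisticalMechanics (ComplexSpin.sgn)
open scoped ComplexConjugate BigOperators ComplexOrder Topology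

namespace Literature.MathematicalPhysics.QuantumLattice

namespace StrongCoupling

open GrassmannAlgebra StaggeredRP StaggeredSingular StaggeredDeterminant

variable {ν L N : ℕ} [NeZero L]

/-! ## 1. `det D₀[U] ≥ 0` -/

/-- The defining representation of `U(N)` is by unitary matrices. [cite: SalmhoferSeiler1991, §2 (2.2)] -/
theorem unitaryFundamentalRep_mem (g : OneLink.UN N) :
    unitaryFundamentalRep (Fin N) ℂ g ∈ Matrix.unitaryGroup (Fin N) ℂ := g.2

/-- `m ↦ det D_m[U]` is continuous. [cite: DegrandDetar2006, §8.1 (8.5)] -/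
theorem continuous_det_staggeredDirac_mass (U : GaugeConfig ν L (OneLink.UN N)) :
    Continuous fun m : ℝ => (staggeredDirac (unitaryFundamentalRep (Fin N) ℂ) U m).det := by
  have h : (fun m : ℝ => (staggeredDirac (unitaryFundamentalRep (Fin N) ℂ) U m).det) =
      fun m : ℝ => (D0 U + (m : ℂ) • (1 : Matrix _ _ ℂ)).det := by
    funext m; rw [staggeredDirac_eq_add_smul_one]
  rw [h]
  exact (continuous_const.add (Complex.continuous_ofReal.smul continuous_const)).matrix_det

/-- **`det D₀[U] ≥ 0` for every gauge field on an even torus**: the limit `m → 0⁺` of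
`det D_m[U] > 0`. [cite: DegrandDetar2006, §8.1 (8.5)] -/
theorem det_D0_re_nonneg (hL : 2 ∣ L) (U : GaugeConfig ν L (OneLink.UN N)) : 0 ≤ ((D0 U).det).re := by
  have hcont : Continuous fun m : ℝ => ((staggeredDirac (unitaryFundamentalRep (Fin N) ℂ) U m).det).re :=
    Complex.continuous_re.comp (continuous_det_staggeredDirac_mass U)
  have htend : Tendsto (fun m : ℝ => ((staggeredDirac (unitaryFundamentalRep (Fin N) ℂ) U m).det).re)
      (𝓝[>] (0 : ℝ)) (𝓝 ((D0 U).det).re) :=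
    (hcont.tendsto 0).mono_left nhdsWithin_le_nhds
  refine ge_of_tendsto htend (eventually_nhdsWithin_of_forall fun m hm => ?_)
  have hpos := det_staggeredDirac_pos (unitaryFundamentalRep (Fin N) ℂ) unitaryFundamentalRep_mem hL U
    (Set.mem_Ioi.1 hm)
  exact (Complex.lt_def.1 hpos).1.le

/-- `det D₀[U]` is a non-negative real number (complex order). [cite: DegrandDetar2006, §8.1 (8.5)] -/
theorem det_D0_nonneg [NeZero ν] (hL : Even L) (U : GaugeConfig ν L (OneLink.UN N)) : 0 ≤ (D0 U).det :=
  Complex.le_def.2 ⟨by simpa using det_D0_re_nonneg (even_iff_two_dvd.1 hL) U,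
    by rw [Complex.zero_im, det_D0_im hL U]⟩

/-- `Re det D₀[U] = 0` exactly on the singular set. [cite: SalmhoferSeiler1991, §2 (2.11)] -/
theorem det_D0_re_eq_zero_iff [NeZero ν] (hL : Even L) (U : GaugeConfig ν L (OneLink.UN N)) :
    ((D0 U).det).re = 0 ↔ (D0 U).det = 0 := by
  constructor
  · intro h
    exact Complex.ext (by simpa using h) (by rw [det_D0_im hL U, Complex.zero_im])
  · intro h; rw [h, Complex.zero_re]

/-! ## 2. `Z_Λ(β, 0) > 0` at every coupling -/

/-- The Wilson weight of `U(N)` on the torus is a finite measure, for every real `β`. [cite: SalmhoferSeiler1991, §2 (2.2), (2.12)] -/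
theorem isFiniteMeasure_wilsonWeight (β : ℝ) :
    IsFiniteMeasure (wilsonWeight (d := ν) (L := L) (unitaryFundamentalRep (Fin N) ℂ) β) := by
  have hρ : Continuous (unitaryFundamentalRep (Fin N) ℂ) := continuous_subtype_val
  have h := (isProbabilityMeasure_wilsonMeasure (d := ν) (L := L) (unitaryFundamentalRep (Fin N) ℂ) hρ β).measure_univ
  simp only [wilsonMeasure, Measure.smul_apply, smul_eq_mul] at h
  have hne : partitionFunction (d := ν) (L := L) (unitaryFundamentalRep (Fin N) ℂ) β ≠ ⊤ := by
    intro htop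
    rw [htop, ENNReal.inv_top, zero_mul] at h
    exact zero_ne_one h
  exact ⟨by rw [show wilsonWeight (d := ν) (L := L) (unitaryFundamentalRep (Fin N) ℂ) β Set.univ =
    partitionFunction (d := ν) (L := L) (unitaryFundamentalRep (Fin N) ℂ) β from rfl]; exact lt_top_iff_ne_top.2 hne⟩

/-- The Wilson weight charges every set of positive Haar measure (its density `e^{-βS_W}` is
positive). [cite: SalmhoferSeiler1991, §2 (2.2), (2.12)] -/
theorem wilsonWeight_apply_eq_zero_iff (β : ℝ) (s : Set (GaugeConfig ν L (OneLink.UN N))) :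
    wilsonWeight (d := ν) (L := L) (unitaryFundamentalRep (Fin N) ℂ) β s = 0 ↔
      (Measure.pi fun _ : Edge ν L => haarProbability (OneLink.UN N)) s = 0 := by
  haveI : SecondCountableTopology (OneLink.UN N) := by
    haveI : SecondCountableTopology (Matrix (Fin N) (Fin N) ℂ) :=
      inferInstanceAs (SecondCountableTopology (Fin N → Fin N → ℂ))
    exact TopologicalSpace.Subtype.secondCountableTopology _
  have hρ : Continuous (unitaryFundamentalRep (Fin N) ℂ) := continuous_subtype_val
  have hmeas : Measurable fun U : GaugeConfig ν L (OneLink.UN N) =>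
      ENNReal.ofReal (Real.exp (-β * wilsonAction (unitaryFundamentalRep (Fin N) ℂ) U)) :=
    ENNReal.measurable_ofReal.comp (Real.measurable_exp.comp ((measurable_wilsonAction _ hρ).const_mul _))
  rw [wilsonWeight, withDensity_apply_eq_zero hmeas]
  have huniv : {U : GaugeConfig ν L (OneLink.UN N) |
      ENNReal.ofReal (Real.exp (-β * wilsonAction (unitaryFundamentalRep (Fin N) ℂ) U)) ≠ 0} = Set.univ :=
    Set.eq_univ_of_forall fun U => (ENNReal.ofReal_pos.2 (Real.exp_pos _)).ne'
  rw [huniv, Set.univ_inter]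

variable [NeZero ν]

omit [NeZero ν] in
/-- `U ↦ Re det D₀[U]` is continuous. [cite: SalmhoferSeiler1991, §2 (2.11)] -/
theorem continuous_det_D0_re : Continuous fun U : GaugeConfig ν L (OneLink.UN N) => ((D0 U).det).re :=
  Complex.continuous_re.comp continuous_D0.matrix_det

/-- **`Z_Λ(β, 0) = ∫ Re det D₀[U] d(wilsonWeight ρ β) > 0` for every real `β`** on an even torus with
`ν ≥ 1`: the massless staggered partition function is positive at every coupling, so the
normalised expectations at `m = 0` are genuine quotients. [cite: SalmhoferSeiler1991, §2 (2.9)–(2.12)] -/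
theorem integral_det_D0_re_wilsonWeight_pos (hL : Even L) (β : ℝ) :
    0 < ∫ U, ((D0 U).det).re ∂(wilsonWeight (d := ν) (L := L) (unitaryFundamentalRep (Fin N) ℂ) β) := by
  haveI := isFiniteMeasure_wilsonWeight (ν := ν) (L := L) (N := N) β
  have hL2 : 2 ∣ L := even_iff_two_dvd.1 hL
  have hnn : 0 ≤ fun U : GaugeConfig ν L (OneLink.UN N) => ((D0 U).det).re := fun U => det_D0_re_nonneg hL2 U
  have hint : Integrable (fun U : GaugeConfig ν L (OneLink.UN N) => ((D0 U).det).re)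
      (wilsonWeight (d := ν) (L := L) (unitaryFundamentalRep (Fin N) ℂ) β) :=
    continuous_det_D0_re.integrable_of_hasCompactSupport (HasCompactSupport.of_compactSpace _)
  rw [integral_pos_iff_support_of_nonneg hnn hint, pos_iff_ne_zero, Ne, wilsonWeight_apply_eq_zero_iff]
  -- the support is the complement of the Haar-null singular set
  have hsupp : Function.support (fun U : GaugeConfig ν L (OneLink.UN N) => ((D0 U).det).re) =
      {U | (D0 U).det = 0}ᶜ := by
    ext U
    rw [Function.mem_support, Set.mem_compl_iff, Set.mem_setOf_eq, Ne, det_D0_re_eq_zero_iff hL U]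
  rw [hsupp, measure_compl measurableSet_setOf_det_D0_eq_zero (measure_ne_top _ _),
    measure_pi_setOf_det_staggeredDirac_eq_zero, measure_univ]
  simp

/-! ## 3. The `m = 0` chiral selection rule for the propagator contraction -/

omit [NeZero L] [NeZero ν] in
/-- `ε(x)² = 1` for Salmhofer–Seiler's staggered sign `ε = ComplexSpin.sgn`. [cite: SalmhoferSeiler1991, §2 (2.8)] -/
theorem sgn_mul_sgn_self (hL : 2 ∣ L) (x : TorusSite ν L) :
    ((ComplexSpin.sgn hL x : ℤ) : ℂ) * ((ComplexSpin.sgn hL x : ℤ) : ℂ) = 1 := by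
  unfold ComplexSpin.sgn
  split_ifs <;> norm_num

/-- **Chiral selection rule for the Wick contraction, every gauge field** (`L` even, `ν ≥ 1`):
`W_{xy}(D₀[U]⁻¹) = 0` whenever `ε(x) = ε(y)` — (3.101)/(3.106) at fixed gauge field, transported to
the propagator form (junk `D₀⁻¹ = 0` on the singular set). [cite: SalmhoferSeiler1991, §3 (3.101), (3.106)] -/
theorem wick2_inv_D0_eq_zero_of_sgn_eq (hL : 2 ∣ L) (U : GaugeConfig ν L (OneLink.UN N)) {x y : TorusSite ν L}
    (hxy : ComplexSpin.sgn hL x = ComplexSpin.sgn hL y) : wick2 (D0 U)⁻¹ x y = 0 := by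
  classical
  have hν : 1 ≤ ν := Nat.one_le_iff_ne_zero.2 (NeZero.ne ν)
  by_cases hU : (D0 U).det = 0
  · -- singular gauge field: the junk propagator vanishes
    have hinv : (D0 U)⁻¹ = 0 := Matrix.nonsing_inv_apply_not_isUnit _ (by rw [hU]; exact not_isUnit_zero)
    simp [wick2, hinv]
  · -- invertible: the Berezin two-point integrand is chirally odd, hence zero for `ε(x) = ε(y)`
    letI : LinearOrder (TorusSite ν L) :=
      LinearOrder.lift' (Fintype.equivFin (TorusSite ν L)) (Fintype.equivFin (TorusSite ν L)).injective
    have hgr := twoPoint_chiralGrading_torus_fixedGauge (N := N) hL hν (stagSigns ν L) U x y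
    rw [hxy, sgn_mul_sgn_self hL y, one_mul] at hgr
    -- `B = -B` forces `B = 0`
    have hB : berezin ℂ _ ((meson x : FermiAlg (TorusSite ν L) N) * meson y *
        fermiBoltzmann (torusLinks ν L) (stagSigns ν L) 0 U) = 0 := by
      have h2 : (2 : ℂ) * berezin ℂ _ ((meson x : FermiAlg (TorusSite ν L) N) * meson y *
          fermiBoltzmann (torusLinks ν L) (stagSigns ν L) 0 U) = 0 := by rw [two_mul]; nth_rw 2 [hgr]; ring
      exact (mul_eq_zero.1 h2).resolve_left two_ne_zero
    have hW := berezin_meson_meson_fermiBoltzmann_torus U hU x y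
    rw [Complex.ofReal_zero, hB] at hW
    have hdet : (-D0 U).det ≠ 0 := by
      rw [Matrix.det_neg]; exact mul_ne_zero (pow_ne_zero _ (neg_ne_zero.2 one_ne_zero)) hU
    exact (mul_eq_zero.1 hW.symm).resolve_left (mul_ne_zero orientationSign_ne_zero hdet)

/-- **At `m = 0` the two-point numerator vanishes between sites of equal parity, for every measure on
the gauge fields** — in particular for the Wilson weight at every `β`:
`∫ Re det D₀[U] · Re W_{xy}(D₀[U]⁻¹) dμ = 0` if `ε(x) = ε(y)`. [cite: SalmhoferSeiler1991, §3 (3.101)] -/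
theorem integral_det_D0_re_mul_wick2_re_eq_zero (hL : 2 ∣ L) (μ : Measure (GaugeConfig ν L (OneLink.UN N)))
    {x y : TorusSite ν L} (hxy : ComplexSpin.sgn hL x = ComplexSpin.sgn hL y) :
    ∫ U, ((D0 U).det).re * (wick2 (D0 U)⁻¹ x y).re ∂μ = 0 := by
  have h : (fun U : GaugeConfig ν L (OneLink.UN N) => ((D0 U).det).re * (wick2 (D0 U)⁻¹ x y).re) = fun _ => 0 := by
    funext U
    rw [wick2_inv_D0_eq_zero_of_sgn_eq hL U hxy, Complex.zero_re, mul_zero]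
  rw [h, integral_zero]

/-- The same in the explicit propagator notation of the conjecture file (origin `0`, site `x`). [cite: SalmhoferSeiler1991, §3 (3.101)] -/
theorem integral_det_re_mul_wick_re_eq_zero_of_sgn_eq (hL : 2 ∣ L) (μ : Measure (GaugeConfig ν L (OneLink.UN N)))
    {x y : TorusSite ν L} (hxy : ComplexSpin.sgn hL x = ComplexSpin.sgn hL y) :
    ∫ U, ((staggeredDirac (unitaryFundamentalRep (Fin N) ℂ) U 0).det).re *
        (let G := (staggeredDirac (unitaryFundamentalRep (Fin N) ℂ) U 0)⁻¹
         ((∑ a : Fin N, G (x, a) (x, a)) * (∑ b : Fin N, G (y, b) (y, b)) -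
            ∑ a : Fin N, ∑ b : Fin N, G (x, a) (y, b) * G (y, b) (x, a)).re) ∂μ = 0 :=
  integral_det_D0_re_mul_wick2_re_eq_zero hL μ hxy

end StrongCoupling

end Literature.MathematicalPhysics.QuantumLattice

end
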